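import Literature.NumberTheory.EllipticCurves.DivisionTowerH1OrderTwoCriterionStabilizer
import HarnessLib

/-!
# `#ker (H¹(G, M) → H¹(N, M)) ≤ 2`, an abstract criterion modelled on `GL₂(ℤ/2^k)` — PART 2:
# coboundaries from vanishing on the stabiliser, and the order bound
# (Lawson–Wuthrich 2016 at the even prime; Sah's lemma with the homothety `3`)

`Proofs`-style file (THEOREMS ONLY), continuing `DivisionTowerH1OrderTwoCriterionStabilizer` (Steps 1–4).
Step 5: an `M[2]`-valued crossed homomorphism vanishing on `N` and on the stabiliser `G_V` of
`V = M[2] = {0, E₁, E₂, E₁ + E₂}` is a coboundary — the coset enumeration `G = ⋃ w G_V` over the six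
words `1, t, t', tt', t't, tt't` in the two transvections (`G/G_V ≅ S₃`) and the explicit choice
`v = [c(t') = E₂]E₁ + [c(t) = E₁]E₂` (`H¹(S₃, 𝔽₂²) = 0` by hand).  Step 6: any two non-zero classes of
the restriction kernel coincide (`Rubin1987.eq_zero_or_eq_zero_or_eq_of_mem_subgroupResKer`: normalise,
read the bit `f(t²) ∈ {0, E₁}`; bit `0` ⇒ coboundary, equal bits ⇒ the difference is a coboundary), hence
`Rubin1987.natCard_subgroupResKer_le_two`.  The hypotheses are the features of `G/N = GL₂(ℤ/2^k)` on
`(ℤ/2^k)²` (central `z` acting as `3`; transvections `t, t'` with the halving property; `s t s⁻¹ ≡ t'`;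
a diagonal family normalised by `t, t'`; `G_V ⊆ ⟨t², t'², d⟩ N`), discharged for elliptic curves with
surjective `ρ̄_{E,2^k}` in a companion file.  «beyond-print theorem»: no (finite group cohomology;
Lawson–Wuthrich 2016 §7.1 report the `p = 2` groups numerically).  BSD is NOT proved by this file.

References: T. Lawson, C. Wuthrich, *Vanishing of some Galois cohomology groups for elliptic curves*
(2016), Lemma 3, §5, §7.1 [LawsonWuthrich2016]; C.-H. Sah, J. Algebra 10 (1968), Prop. 2.7 (b) [Sah1968];
J.-P. Serre, *Galois Cohomology*, I.§5.8 [SerreGaloisCohomology1997].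
-/

set_option autoImplicit false

noncomputable section

open scoped Classical

open Literature.NumberTheory.GaloisRepresentations

universe u

namespace Literature.NumberTheory.EllipticCurves

namespace Rubin1987

section OrderTwoAlgebra

variable {G : Type u} [Group G] {M : Type u} [AddCommGroup M] [DistribMulAction G M]
variable {N : Subgroup G}

/-- A coboundary `g ↦ g • w − w` of an `N`-INVARIANT `w` is a crossed homomorphism vanishing on `N`.
[folklore] -/
private theorem coboundary_mem' (w : M) (hw : ∀ n ∈ N, n • w = w) :
    (fun g : G ↦ g • w - w) ∈ cocyclesVanishingOn M N := by
  refine ⟨fun g h ↦ ?_, fun n hn ↦ by simp only [hw n hn, sub_self]⟩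
  simp only [mul_smul, smul_sub]
  abel

/-! #### Step 5: a crossed homomorphism vanishing on `G_V`, `t`, `t'` vanishes; coboundaries -/

/-- Membership in the stabiliser `G_V` of `V = {0, E₁, E₂, E₁ + E₂}` is tested on `E₁, E₂`.
[cite: LawsonWuthrich2016, §2 (reduction G_i → GL₂(𝔽_p))] -/
theorem mem_fixingSubgroup_of_smul_eq {E₁ E₂ : M}
    (hV : ∀ v : M, (2 : ℤ) • v = 0 → v = 0 ∨ v = E₁ ∨ v = E₂ ∨ v = E₁ + E₂)
    {g : G} (h₁ : g • E₁ = E₁) (h₂ : g • E₂ = E₂) :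
    g ∈ fixingSubgroup G {v : M | (2 : ℤ) • v = 0} := by
  refine (mem_fixingSubgroup_iff G).2 fun v hv ↦ ?_
  rcases hV v hv with h | h | h | h
  · rw [h]; exact smul_zero _
  · rw [h]; exact h₁
  · rw [h]; exact h₂
  · rw [h, smul_add, h₁, h₂]

/-- **Coset enumeration `G = ⋃ w · G_V`** over the six words `1, t, t', t t', t' t, t t' t`: the pair
`(g E₁, g E₂)` runs over the six ordered pairs of distinct non-zero elements of `V`, each realised by
one word (`G/G_V ↪ GL(V) ≅ S₃ = ⟨t̄, t̄'⟩`, the reduction `G → GL₂(𝔽₂)` of Lawson–Wuthrich §2).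
[cite: LawsonWuthrich2016, §2 (reduction G_i → GL₂(𝔽_p)) and §5] -/
theorem exists_word_mul_of_transvections {E₁ E₂ : M} (h2E₁ : (2 : ℤ) • E₁ = 0)
    (h2E₂ : (2 : ℤ) • E₂ = 0) (hE₁ : E₁ ≠ 0) (hE₂ : E₂ ≠ 0) (hE₁₂ : E₁ ≠ E₂)
    (hV : ∀ v : M, (2 : ℤ) • v = 0 → v = 0 ∨ v = E₁ ∨ v = E₂ ∨ v = E₁ + E₂)
    {t t' : G} (ht₁ : t • E₁ = E₁) (ht₂ : t • E₂ = E₁ + E₂) (ht'₁ : t' • E₁ = E₁ + E₂)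
    (ht'₂ : t' • E₂ = E₂) (g : G) :
    ∃ w : G, (w = 1 ∨ w = t ∨ w = t' ∨ w = t * t' ∨ w = t' * t ∨ w = t * t' * t) ∧
      w⁻¹ * g ∈ fixingSubgroup G {v : M | (2 : ℤ) • v = 0} := by
  have h11 : E₁ + E₁ = 0 := by rw [← two_zsmul, h2E₁]
  have h22 : E₂ + E₂ = 0 := by rw [← two_zsmul, h2E₂]
  have hE₁₂' : E₁ + E₂ ≠ 0 := fun h ↦ hE₁₂ <| by
    rw [← sub_eq_zero, sub_eq_add_neg, show -E₂ = E₂ from by rw [neg_eq_iff_add_eq_zero, h22], h]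
  -- the images of `E₁, E₂` under the six words
  have w1₁ : (1 : G) • E₁ = E₁ := one_smul _ _
  have w1₂ : (1 : G) • E₂ = E₂ := one_smul _ _
  have w4₁ : (t * t') • E₁ = E₂ := by rw [mul_smul, ht'₁, smul_add, ht₁, ht₂, ← add_assoc, h11, zero_add]
  have w4₂ : (t * t') • E₂ = E₁ + E₂ := by rw [mul_smul, ht'₂, ht₂]
  have w5₁ : (t' * t) • E₁ = E₁ + E₂ := by rw [mul_smul, ht₁, ht'₁]
  have w5₂ : (t' * t) • E₂ = E₁ := by rw [mul_smul, ht₂, smul_add, ht'₁, ht'₂, add_assoc, h22, add_zero]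
  have w6₁ : (t * t' * t) • E₁ = E₂ := by rw [mul_smul, ht₁, w4₁]
  have w6₂ : (t * t' * t) • E₂ = E₁ := by
    rw [mul_smul, ht₂, smul_add, w4₁, w4₂, ← add_assoc, add_comm E₂ E₁, add_assoc, h22, add_zero]
  -- `g E₁`, `g E₂` are distinct non-zero elements of `V`
  have hA : (2 : ℤ) • (g • E₁) = 0 := by rw [smul_comm, h2E₁, smul_zero]
  have hB : (2 : ℤ) • (g • E₂) = 0 := by rw [smul_comm, h2E₂, smul_zero]
  have hA0 : g • E₁ ≠ 0 := fun h ↦ hE₁ (by rwa [smul_eq_zero_iff_eq] at h)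
  have hB0 : g • E₂ ≠ 0 := fun h ↦ hE₂ (by rwa [smul_eq_zero_iff_eq] at h)
  have hAB : g • E₁ ≠ g • E₂ := fun h ↦ hE₁₂ (smul_left_cancel g h)
  -- conclude by cases
  have key : ∀ w : G, w • E₁ = g • E₁ → w • E₂ = g • E₂ →
      w⁻¹ * g ∈ fixingSubgroup G {v : M | (2 : ℤ) • v = 0} := fun w hw₁ hw₂ ↦
    mem_fixingSubgroup_of_smul_eq hV (by rw [mul_smul, ← hw₁, inv_smul_smul])
      (by rw [mul_smul, ← hw₂, inv_smul_smul])
  rcases hV _ hA with hA' | hA' | hA' | hA' <;> rcases hV _ hB with hB' | hB' | hB' | hB'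
  all_goals first
    | exact absurd hA' hA0
    | exact absurd hB' hB0
    | exact absurd (hA'.trans hB'.symm) hAB
    | skip
  · exact ⟨1, Or.inl rfl, key 1 (w1₁.trans hA'.symm) (w1₂.trans hB'.symm)⟩
  · exact ⟨t, Or.inr (Or.inl rfl), key t (ht₁.trans hA'.symm) (ht₂.trans hB'.symm)⟩
  · exact ⟨t * t' * t, Or.inr (Or.inr (Or.inr (Or.inr (Or.inr rfl)))),
      key _ (w6₁.trans hA'.symm) (w6₂.trans hB'.symm)⟩
  · exact ⟨t * t', Or.inr (Or.inr (Or.inr (Or.inl rfl))), key _ (w4₁.trans hA'.symm) (w4₂.trans hB'.symm)⟩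
  · exact ⟨t' * t, Or.inr (Or.inr (Or.inr (Or.inr (Or.inl rfl)))),
      key _ (w5₁.trans hA'.symm) (w5₂.trans hB'.symm)⟩
  · exact ⟨t', Or.inr (Or.inr (Or.inl rfl)), key t' (ht'₁.trans hA'.symm) (ht'₂.trans hB'.symm)⟩

/-- A crossed homomorphism vanishing on `G_V`, `t` and `t'` vanishes identically. [folklore] -/
private theorem apply_eq_zero_of_apply_transvections_eq_zero (c : cocyclesVanishingOn M N)
    {E₁ E₂ : M} (h2E₁ : (2 : ℤ) • E₁ = 0) (h2E₂ : (2 : ℤ) • E₂ = 0) (hE₁ : E₁ ≠ 0) (hE₂ : E₂ ≠ 0)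
    (hE₁₂ : E₁ ≠ E₂) (hV : ∀ v : M, (2 : ℤ) • v = 0 → v = 0 ∨ v = E₁ ∨ v = E₂ ∨ v = E₁ + E₂)
    {t t' : G} (ht₁ : t • E₁ = E₁) (ht₂ : t • E₂ = E₁ + E₂) (ht'₁ : t' • E₁ = E₁ + E₂)
    (ht'₂ : t' • E₂ = E₂) (hc : ∀ g ∈ fixingSubgroup G {v : M | (2 : ℤ) • v = 0}, c.1 g = 0)
    (hct : c.1 t = 0) (hct' : c.1 t' = 0) (g : G) : c.1 g = 0 := by
  have c1 : c.1 1 = 0 := by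
    have h := cocyclesVanishingOn.cocycle c (1 : G) 1
    rw [mul_one, one_smul, left_eq_add] at h
    exact h
  have ctt' : c.1 (t * t') = 0 := by rw [cocyclesVanishingOn.cocycle c, hct, hct', smul_zero, add_zero]
  have ct't : c.1 (t' * t) = 0 := by rw [cocyclesVanishingOn.cocycle c, hct', hct, smul_zero, add_zero]
  have ctt't : c.1 (t * t' * t) = 0 := by
    rw [cocyclesVanishingOn.cocycle c, ctt', hct, smul_zero, add_zero]
  obtain ⟨w, hw, hmem⟩ :=
    exists_word_mul_of_transvections h2E₁ h2E₂ hE₁ hE₂ hE₁₂ hV ht₁ ht₂ ht'₁ ht'₂ g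
  have hg : g = w * (w⁻¹ * g) := by rw [mul_inv_cancel_left]
  rw [hg, cocyclesVanishingOn.cocycle c, hc _ hmem, smul_zero, add_zero]
  rcases hw with rfl | rfl | rfl | rfl | rfl | rfl
  exacts [c1, hct, hct', ctt', ct't, ctt't]

/-- **Coboundary.** An `M[2]`-valued crossed homomorphism vanishing on `N` (which acts trivially on
`M`) and on `G_V` is the coboundary of some `v ∈ V`: `c(t) ∈ {0, E₁}`, `c(t') ∈ {0, E₂}` (from
`c(t²) = c(t'²) = 0`), and `v = [c(t') = E₂] E₁ + [c(t) = E₁] E₂` works (`H¹(S₃, 𝔽₂²) = 0` by hand).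
[cite: LawsonWuthrich2016, Lemma 3, §5 (H¹(G, E[2]) = 0)] -/
theorem exists_eq_smul_sub_of_apply_fixingSubgroup_eq_zero
    (hNM : ∀ n ∈ N, ∀ x : M, n • x = x) (c : cocyclesVanishingOn M N)
    (hcV : ∀ g, (2 : ℤ) • c.1 g = 0)
    {E₁ E₂ : M} (h2E₁ : (2 : ℤ) • E₁ = 0) (h2E₂ : (2 : ℤ) • E₂ = 0) (hE₁ : E₁ ≠ 0) (hE₂ : E₂ ≠ 0)
    (hE₁₂ : E₁ ≠ E₂) (hV : ∀ v : M, (2 : ℤ) • v = 0 → v = 0 ∨ v = E₁ ∨ v = E₂ ∨ v = E₁ + E₂)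
    {t t' : G} (ht₁ : t • E₁ = E₁) (ht₂ : t • E₂ = E₁ + E₂) (ht'₁ : t' • E₁ = E₁ + E₂)
    (ht'₂ : t' • E₂ = E₂) (hc : ∀ g ∈ fixingSubgroup G {v : M | (2 : ℤ) • v = 0}, c.1 g = 0) :
    ∃ v : M, (2 : ℤ) • v = 0 ∧ ∀ g, c.1 g = g • v - v := by
  have h11 : E₁ + E₁ = 0 := by rw [← two_zsmul, h2E₁]
  have h22 : E₂ + E₂ = 0 := by rw [← two_zsmul, h2E₂]
  have hV' : ∀ v : M, (2 : ℤ) • v = 0 → v = 0 ∨ v = E₂ ∨ v = E₁ ∨ v = E₂ + E₁ := fun v hv ↦ by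
    rcases hV v hv with h | h | h | h
    · exact Or.inl h
    · exact Or.inr (Or.inr (Or.inl h))
    · exact Or.inr (Or.inl h)
    · exact Or.inr (Or.inr (Or.inr (h.trans (add_comm _ _))))
  -- reduction: it suffices to find `v ∈ V` matching `c` at `t` and `t'`
  have reduce : ∀ v : M, (2 : ℤ) • v = 0 → t • v - v = c.1 t → t' • v - v = c.1 t' →
      ∀ g, c.1 g = g • v - v := by
    intro v hv hvt hvt' g
    set c' : cocyclesVanishingOn M N :=
      ⟨fun g ↦ c.1 g - (g • v - v), (cocyclesVanishingOn M N).sub_mem c.2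
        (coboundary_mem' v fun n hn ↦ hNM n hn v)⟩ with hc'
    have hc'V : ∀ g ∈ fixingSubgroup G {v : M | (2 : ℤ) • v = 0}, c'.1 g = 0 := fun g hg ↦ by
      change c.1 g - (g • v - v) = 0
      rw [hc g hg, (mem_fixingSubgroup_iff G).1 hg v hv, sub_self, sub_zero]
    have h := apply_eq_zero_of_apply_transvections_eq_zero c' h2E₁ h2E₂ hE₁ hE₂ hE₁₂ hV ht₁ ht₂
      ht'₁ ht'₂ hc'V (by change c.1 t - (t • v - v) = 0; rw [hvt, sub_self])
      (by change c.1 t' - (t' • v - v) = 0; rw [hvt', sub_self]) g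
    change c.1 g - (g • v - v) = 0 at h
    exact sub_eq_zero.1 h
  -- `c(t) ∈ {0, E₁}`, `c(t') ∈ {0, E₂}` from `c(t²) = c(t'²) = 0`
  have neg_of_two : ∀ x : M, (2 : ℤ) • x = 0 → -x = x := fun x hx ↦ by
    rw [neg_eq_iff_add_eq_zero, ← two_zsmul, hx]
  have hfix : ∀ x : G, x * x ∈ fixingSubgroup G {v : M | (2 : ℤ) • v = 0} → x • c.1 x = c.1 x :=
    fun x hxx ↦ by
    have h := hc _ hxx
    rw [cocyclesVanishingOn.cocycle c] at h
    rw [eq_neg_of_add_eq_zero_right h, neg_of_two _ (hcV x)]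
  have htt : t * t ∈ fixingSubgroup G {v : M | (2 : ℤ) • v = 0} :=
    mul_self_mem_fixingSubgroup h2E₁ hV ht₁ ht₂
  have ht't' : t' * t' ∈ fixingSubgroup G {v : M | (2 : ℤ) • v = 0} :=
    mul_self_mem_fixingSubgroup h2E₂ hV' ht'₂ (by rw [ht'₁, add_comm])
  have hct : c.1 t = 0 ∨ c.1 t = E₁ := eq_zero_or_eq_of_smul_eq h2E₁ hE₁ hV ht₁ ht₂ (hcV t) (hfix t htt)
  have hct' : c.1 t' = 0 ∨ c.1 t' = E₂ :=
    eq_zero_or_eq_of_smul_eq h2E₂ hE₂ hV' ht'₂ (by rw [ht'₁, add_comm]) (hcV t') (hfix t' ht't')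
  have h2E₁₂ : (2 : ℤ) • (E₁ + E₂) = 0 := by rw [smul_add, h2E₁, h2E₂, add_zero]
  rcases hct with h0 | h0 <;> rcases hct' with h0' | h0'
  · exact ⟨0, smul_zero _, reduce 0 (smul_zero _) (by rw [smul_zero, sub_zero, h0])
      (by rw [smul_zero, sub_zero, h0'])⟩
  · exact ⟨E₁, h2E₁, reduce E₁ h2E₁ (by rw [ht₁, sub_self, h0])
      (by rw [ht'₁, add_sub_cancel_left, h0'])⟩
  · exact ⟨E₂, h2E₂, reduce E₂ h2E₂ (by rw [ht₂, add_sub_cancel_right, h0])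
      (by rw [ht'₂, sub_self, h0'])⟩
  · exact ⟨E₁ + E₂, h2E₁₂, reduce (E₁ + E₂) h2E₁₂
      (by rw [smul_add, ht₁, ht₂, add_sub_cancel_right, h0])
      (by rw [smul_add, ht'₁, ht'₂, add_sub_cancel_left, h0'])⟩

/-- `f(t²) ∈ {0, E₁}` for an `M[2]`-valued crossed homomorphism (`f(t²) = f(t) + t f(t)`).
[cite: LawsonWuthrich2016, §5 (H¹(⟨h⟩, E[2]) for a transvection h)] -/
theorem apply_mul_self_eq_zero_or_eq (f : cocyclesVanishingOn M N) (hfV : ∀ g, (2 : ℤ) • f.1 g = 0)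
    {E₁ E₂ : M} (h2E₁ : (2 : ℤ) • E₁ = 0) (h2E₂ : (2 : ℤ) • E₂ = 0)
    (hV : ∀ v : M, (2 : ℤ) • v = 0 → v = 0 ∨ v = E₁ ∨ v = E₂ ∨ v = E₁ + E₂)
    {t : G} (ht₁ : t • E₁ = E₁) (ht₂ : t • E₂ = E₁ + E₂) :
    f.1 (t * t) = 0 ∨ f.1 (t * t) = E₁ := by
  have h11 : E₁ + E₁ = 0 := by rw [← two_zsmul, h2E₁]
  have h22 : E₂ + E₂ = 0 := by rw [← two_zsmul, h2E₂]
  rw [cocyclesVanishingOn.cocycle f]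
  rcases hV _ (hfV t) with h | h | h | h <;> rw [h]
  · left; rw [smul_zero, add_zero]
  · left; rw [ht₁, h11]
  · right; rw [ht₂, ← add_assoc, add_comm E₂ E₁, add_assoc, h22, add_zero]
  · right; rw [smul_add, ht₁, ht₂, ← add_assoc E₁ E₁ E₂, h11, zero_add, add_assoc, h22, add_zero]

end OrderTwoAlgebra

/-! #### Step 6: the order bound -/

section OrderTwo

variable {G : Type u} [Group G] [TopologicalSpace G] [IsTopologicalGroup G]
variable {M : Type u} [AddCommGroup M] [DistribMulAction G M] [TopologicalSpace M]
  [DiscreteTopology M]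
variable {N : Subgroup G} [N.Normal]

omit [N.Normal] in
/-- The inflated class of a coboundary-shifted cocycle is unchanged. [folklore] -/
private theorem inflClass_eq_of_shift (hN : IsOpen (N : Set G)) (f f' : cocyclesVanishingOn M N)
    (w : M) (h : ∀ g, f'.1 g = f.1 g - (g • w - w)) :
    inflClass M N hN f' = inflClass M N hN f := by
  rw [← sub_eq_zero, ← map_sub, inflClass_apply, GaloisRepresentations.oneCocycleClass_eq_zero_iff]
  refine ⟨-w, fun g ↦ ?_⟩
  rw [discreteTopRep_ρ_apply, toContOneCocycle_apply]
  change f'.1 g - f.1 g = g • (-w) - (-w)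
  rw [h g, smul_neg]
  abel

/-- **Any two non-zero classes of `ker (H¹(G, M) → H¹(N, M))` coincide** under the `GL₂(ℤ/2^k)`
hypotheses: `N ⊴ G` open acting trivially on `M`; `z` central modulo `N` acting as `3`; `t, t'` with the
halving property on `M` and acting on `V = M[2] = {0, E₁, E₂, E₁ + E₂}` as the standard transvections;
`s t s⁻¹ ≡ t' (mod N)`; a diagonal family `d ⊆ G_V` normalised by `t, t'` up to powers of `t², t'²`
modulo `N`; `G_V ⊆ ⟨t², t'², d⟩ · N`.  (Normalise both classes to `M[2]`-valued cocycles; the bit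
`f(t²) ∈ {0, E₁}` decides: bit `0` ⇒ the cocycle vanishes on `G_V` ⇒ coboundary; equal bits ⇒ the
difference is a coboundary.) [cite: LawsonWuthrich2016, Lemma 3, §7.1] [cite: Sah1968, Prop. 2.7 (b)] -/
theorem eq_zero_or_eq_zero_or_eq_of_mem_subgroupResKer (hN : IsOpen (N : Set G))
    (hNM : ∀ n ∈ N, ∀ x : M, n • x = x)
    {z : G} (hzc : ∀ g : G, ∃ n ∈ N, z * g = g * z * n) (hz : ∀ x : M, z • x = (3 : ℤ) • x)
    {E₁ E₂ : M} (h2E₁ : (2 : ℤ) • E₁ = 0) (h2E₂ : (2 : ℤ) • E₂ = 0) (hE₁ : E₁ ≠ 0) (hE₂ : E₂ ≠ 0)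
    (hE₁₂ : E₁ ≠ E₂) (hV : ∀ v : M, (2 : ℤ) • v = 0 → v = 0 ∨ v = E₁ ∨ v = E₂ ∨ v = E₁ + E₂)
    {t t' s : G}
    (hhalf : ∀ x : M, (∃ y : M, t • x - x = (2 : ℤ) • y) → (∃ y : M, t' • x - x = (2 : ℤ) • y) →
      ∃ w : M, x = (2 : ℤ) • w)
    (ht₁ : t • E₁ = E₁) (ht₂ : t • E₂ = E₁ + E₂) (ht'₁ : t' • E₁ = E₁ + E₂)
    (ht'₂ : t' • E₂ = E₂) (hst : ∃ n ∈ N, s * t * s⁻¹ = t' * n)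
    {ι : Type*} (d : ι → G) (hdV : ∀ i, d i ∈ fixingSubgroup G {v : M | (2 : ℤ) • v = 0})
    (hdt : ∀ i, ∃ (m : ℤ), ∃ n ∈ N, t * d i * t⁻¹ = d i * (t * t) ^ m * n)
    (hdt' : ∀ i, ∃ (m : ℤ), ∃ n ∈ N, t' * d i * t'⁻¹ = d i * (t' * t') ^ m * n)
    (hgen : ∀ g ∈ fixingSubgroup G {v : M | (2 : ℤ) • v = 0},
      ∃ w ∈ Subgroup.closure ({t * t, t' * t'} ∪ Set.range d), ∃ n ∈ N, g = w * n)
    {κ₁ κ₂ : discreteH1 G M} (hκ₁ : κ₁ ∈ subgroupResKer M N) (hκ₂ : κ₂ ∈ subgroupResKer M N) :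
    κ₁ = 0 ∨ κ₂ = 0 ∨ κ₁ = κ₂ := by
  have hle := resKer_le_range_inflClass (subgroupIncl N) (AddMonoidHom.id M) (fun _ _ ↦ rfl)
    Function.bijective_id N hN (fun n hn ↦ ⟨⟨n, hn⟩, rfl⟩)
  obtain ⟨f₁, rfl⟩ := hle hκ₁
  obtain ⟨f₂, rfl⟩ := hle hκ₂
  -- normalise
  obtain ⟨w₁, f₁', hf₁', hV₁⟩ := exists_two_zsmul_apply_eq_zero hNM f₁ hzc hz hhalf
  obtain ⟨w₂, f₂', hf₂', hV₂⟩ := exists_two_zsmul_apply_eq_zero hNM f₂ hzc hz hhalf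
  rw [← inflClass_eq_of_shift hN f₁ f₁' w₁ hf₁', ← inflClass_eq_of_shift hN f₂ f₂' w₂ hf₂']
  -- a normalised cocycle with bit `0` is a coboundary
  have cob : ∀ f : cocyclesVanishingOn M N, (∀ g, (2 : ℤ) • f.1 g = 0) → f.1 (t * t) = 0 →
      inflClass M N hN f = 0 := by
    intro f hfV hu
    have hvan := apply_eq_zero_of_mem_fixingSubgroup_of_apply_mul_self_eq_zero f hfV h2E₁ h2E₂ hE₁
      hE₂ hV ht₁ ht₂ ht'₁ ht'₂ hst d hdV hdt hdt' hgen hu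
    obtain ⟨v, -, hv⟩ := exists_eq_smul_sub_of_apply_fixingSubgroup_eq_zero hNM f hfV h2E₁ h2E₂
      hE₁ hE₂ hE₁₂ hV ht₁ ht₂ ht'₁ ht'₂ hvan
    rw [inflClass_apply, GaloisRepresentations.oneCocycleClass_eq_zero_iff]
    exact ⟨v, fun g ↦ by rw [discreteTopRep_ρ_apply, toContOneCocycle_apply]; exact hv g⟩
  rcases apply_mul_self_eq_zero_or_eq f₁' hV₁ h2E₁ h2E₂ hV ht₁ ht₂ with b₁ | b₁
  · exact Or.inl (cob f₁' hV₁ b₁)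
  rcases apply_mul_self_eq_zero_or_eq f₂' hV₂ h2E₁ h2E₂ hV ht₁ ht₂ with b₂ | b₂
  · exact Or.inr (Or.inl (cob f₂' hV₂ b₂))
  -- equal bits: the difference is a coboundary
  refine Or.inr (Or.inr ?_)
  rw [← sub_eq_zero, ← map_sub]
  refine cob (f₁' - f₂') (fun g ↦ ?_) ?_
  · change (2 : ℤ) • (f₁'.1 g - f₂'.1 g) = 0
    rw [smul_sub, hV₁, hV₂, sub_self]
  · change f₁'.1 (t * t) - f₂'.1 (t * t) = 0
    rw [b₁, b₂, sub_self]

omit [TopologicalSpace G] [IsTopologicalGroup G] [DistribMulAction G M] [TopologicalSpace M]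
  [DiscreteTopology M] [N.Normal] in
/-- An additive subgroup in which any two non-zero elements coincide has at most two elements
(inject into `Bool` by `κ ↦ [κ = 0]`) — the counting form in which Lawson–Wuthrich report the `p = 2`
groups (`H¹ ≅ ℤ/2`). [cite: LawsonWuthrich2016, §7.1] -/
theorem natCard_le_two_of_forall_eq_zero_or {X : Type*} [AddCommGroup X] (H : AddSubgroup X)
    (h : ∀ a ∈ H, ∀ b ∈ H, a = 0 ∨ b = 0 ∨ a = b) : Nat.card H ≤ 2 := by
  let φ : H → Bool := fun κ ↦ decide ((κ : X) = 0)
  have hφ : Function.Injective φ := by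
    intro κ₁ κ₂ hk
    have h' : ((κ₁ : X) = 0) ↔ ((κ₂ : X) = 0) := by simpa [φ] using hk
    rcases h κ₁ κ₁.2 κ₂ κ₂.2 with h0 | h0 | h0
    · exact Subtype.ext (h0.trans (h'.1 h0).symm)
    · exact Subtype.ext ((h'.2 h0).trans h0.symm)
    · exact Subtype.ext h0
  have hc := Nat.card_le_card_of_injective φ hφ
  rwa [Nat.card_eq_fintype_card (α := Bool), Fintype.card_bool] at hc

/-- **`#ker (H¹(G, M) → H¹(N, M)) ≤ 2`** under the hypotheses of
`eq_zero_or_eq_zero_or_eq_of_mem_subgroupResKer` (the injection `κ ↦ [κ = 0]` into `Bool`).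
[cite: LawsonWuthrich2016, Lemma 3, §7.1] -/
theorem natCard_subgroupResKer_le_two (hN : IsOpen (N : Set G))
    (hNM : ∀ n ∈ N, ∀ x : M, n • x = x)
    {z : G} (hzc : ∀ g : G, ∃ n ∈ N, z * g = g * z * n) (hz : ∀ x : M, z • x = (3 : ℤ) • x)
    {E₁ E₂ : M} (h2E₁ : (2 : ℤ) • E₁ = 0) (h2E₂ : (2 : ℤ) • E₂ = 0) (hE₁ : E₁ ≠ 0) (hE₂ : E₂ ≠ 0)
    (hE₁₂ : E₁ ≠ E₂) (hV : ∀ v : M, (2 : ℤ) • v = 0 → v = 0 ∨ v = E₁ ∨ v = E₂ ∨ v = E₁ + E₂)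
    {t t' s : G}
    (hhalf : ∀ x : M, (∃ y : M, t • x - x = (2 : ℤ) • y) → (∃ y : M, t' • x - x = (2 : ℤ) • y) →
      ∃ w : M, x = (2 : ℤ) • w)
    (ht₁ : t • E₁ = E₁) (ht₂ : t • E₂ = E₁ + E₂) (ht'₁ : t' • E₁ = E₁ + E₂)
    (ht'₂ : t' • E₂ = E₂) (hst : ∃ n ∈ N, s * t * s⁻¹ = t' * n)
    {ι : Type*} (d : ι → G) (hdV : ∀ i, d i ∈ fixingSubgroup G {v : M | (2 : ℤ) • v = 0})
    (hdt : ∀ i, ∃ (m : ℤ), ∃ n ∈ N, t * d i * t⁻¹ = d i * (t * t) ^ m * n)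
    (hdt' : ∀ i, ∃ (m : ℤ), ∃ n ∈ N, t' * d i * t'⁻¹ = d i * (t' * t') ^ m * n)
    (hgen : ∀ g ∈ fixingSubgroup G {v : M | (2 : ℤ) • v = 0},
      ∃ w ∈ Subgroup.closure ({t * t, t' * t'} ∪ Set.range d), ∃ n ∈ N, g = w * n) :
    Nat.card (subgroupResKer M N) ≤ 2 :=
  natCard_le_two_of_forall_eq_zero_or _ fun _ ha _ hb ↦
    eq_zero_or_eq_zero_or_eq_of_mem_subgroupResKer hN hNM hzc hz h2E₁ h2E₂ hE₁ hE₂ hE₁₂ hV hhalf ht₁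
      ht₂ ht'₁ ht'₂ hst d hdV hdt hdt' hgen ha hb

end OrderTwo

end Rubin1987

end Literature.NumberTheory.EllipticCurves

end
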